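import Literature.NumberTheory.Sieve.CubicBoxModelMainTerm
import Literature.NumberTheory.Sieve.CubicFormClassCountBounds
import HarnessLib

/-!
# Class sums of the box model of the Heath-Brown weight: mass, local densities, upper bounds, PROVED

Topic `Literature/NumberTheory/Sieve`, namespace `Literature.NumberTheory.Sieve.CubicMinorant`
(continuation of `CubicBoxModelMainTerm.lean`: the box model
`ũ(m) = (U/R)·#{(x,y) ∈ ℬ : x³+2y³ = m, (m, P) = 1}` of the Heath-Brown weight, `P = P(z)`,
`R = #{(x,y) ∈ ℬ : (x³+2y³, P) = 1}`).

For the dispersion of `n = p + (x³ + 2y³)` (parity-ideate route `GoldbachHeathBrownDispersion`, crux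
ModelDispersion) one needs the distribution of `ũ` in residue classes `k ≡ r (mod d)`.  We PROVE:

* `sum_boxModel_filter_eq`, `sum_boxModel_eq_mass` — the class sums of `ũ` are sifted class counts of the
  box, `∑_{k ≡ r} ũ(k) = (U/R)·#{(x,y) ∈ ℬ : v ≡ r (d), (v, P) = 1}`, and `∑_k ũ(k) = U`;
* **`exists_classRough_ratio_le`** — the two-dimensional Fundamental Lemma for a class of pairs in RATIO
  FORM: for every `θ > 0` there are `K, C` (depending on `θ` only) with
  `|#{(x,y) ∈ classBoxPairs(d;a,b) : (x³+2y³, P(z)) = 1} − (L/d)² V_d(z)| ≤ θ (L/d)² V_d(z)` for every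
  admissible class, as soon as `z ≥ 3` and `L/d ≥ C z^K` (tree `abs_card_classBoxPairs_rough_sub_le`
  with `D = z^J`, `J = J(θ)`); `exists_boxRough_ratio_le` is the case `d = 1`;
* `classSieveProduct_le_two_pow_mul` — `V_d(z) ≤ 2^{ω(d)} V(z)`;
* **`abs_classCount_div_sub_density_le`** — the MODEL HAS THE LOCAL DENSITIES of `x³+2y³`: if every
  admissible class count is within the factor `1 ± θ` of `(L/d)² V_d(z)` (`θ ≤ 1/4`) and the primes of
  `d` are below `z`, then for every `r`
  `|#{ℬ : v ≡ r (d), (v,P)=1}/R − ν_d(r)1[(r,d)=1]/ν_d^*| ≤ 3θ`,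
  `ν_d^* = #{(a,b) mod d : (a³+2b³, d) = 1}` — hence `|∑_{k≡r} ũ(k) − ρ(d,r) U| ≤ 3θ U`
  (`abs_sum_boxModel_filter_sub_le`).

No new facts. Written for the parity-ideate cell (literature seat g14, 2026-08-27).
[HalberstamRichert1974, Thm 2.5; HeathBrownMoroz2004, §2 (2.3)–(2.4), §3 (3.1)–(3.3);
BombieriFriedlanderIwaniecActa1986, §3.]

## References

* [HalberstamRichert1974] H. Halberstam, H.-E. Richert, *Sieve Methods*, Thm 2.5 (Fundamental Lemma).
* [HeathBrownMoroz2004] D. R. Heath-Brown, B. Z. Moroz, Proc. LMS (3) 88 (2004), §2 (2.3)–(2.4), §3.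
* [BombieriFriedlanderIwaniecActa1986] Bombieri–Friedlander–Iwaniec, Acta Math. 156 (1986), §3.

## Mathlib / tree search

Tree: `abs_card_classBoxPairs_rough_sub_le`, `card_classBoxPairs_rough_eq_zero`,
`card_box_modEq_rough_eq_sum`, `card_box_rough_eq_sum`, `classSieveProduct(_eq/_pos/_le_one)`,
`classBoxPairs_one`, `densityProduct_seqPairBox_one_eq`, `densityProduct_seqPairBox_eq`,
`oneClassProduct_ge`, `one_sub_pairZeroCount_div_bounds`, `cubicClassCount_eq_of_coprime`
(`CubicForm*`, `HeathBrownWeightClassSums`); `sum_boxModel_mul_roughModel_eq` (`CubicBoxModelMainTerm`).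
-/

noncomputable section

open Finset Filter
open Literature.NumberTheory.Sieve Literature.NumberTheory.Sieve.CubicPrimes

namespace Literature.NumberTheory.Sieve.CubicMinorant

/-! ### Class sums of the box model are sifted class counts -/

/-- Fibrewise: `∑_{k ∈ S} #{xy ∈ ℬ : v(xy) = k, p k} = #{xy ∈ ℬ : v(xy) ∈ S, p (v xy)}` (private helper).
[folklore] -/
private theorem sum_card_fiber_eq (box : Finset (ℕ × ℕ)) (S : Finset ℕ) (v : ℕ × ℕ → ℕ)
    (p : ℕ → Prop) [DecidablePred p] :
    ∑ k ∈ S, (#{xy ∈ box | v xy = k ∧ p k} : ℝ) = #{xy ∈ box | v xy ∈ S ∧ p (v xy)} := by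
  have h1 : ∀ k ∈ S, (#{xy ∈ box | v xy = k ∧ p k} : ℝ) =
      ∑ xy ∈ (box.filter (fun xy => p (v xy))) with v xy = k, (1 : ℝ) := by
    intro k _
    have hset : (box.filter (fun xy => p (v xy))).filter (fun xy => v xy = k) =
        box.filter (fun xy => v xy = k ∧ p k) := by
      rw [filter_filter]
      refine filter_congr fun xy _ => ?_
      constructor
      · rintro ⟨hp, hk⟩
        exact ⟨hk, hk ▸ hp⟩
      · rintro ⟨hk, hp⟩
        exact ⟨hk ▸ hp, hk⟩
    rw [hset, sum_const, nsmul_eq_mul, mul_one]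
  rw [sum_congr rfl h1, sum_fiberwise_eq_sum_filter, filter_filter, sum_const, nsmul_eq_mul, mul_one]
  congr 2
  exact filter_congr fun xy _ => and_comm

/-- **Class sums of the box model**: for any finite set `S` of values (e.g. `{k ≤ N : k ≡ r (mod d)}`),
`∑_{k∈S} ũ(k) = (U/R) · #{xy ∈ ℬ : v ∈ S, (v, P) = 1}`.
[cite: BombieriFriedlanderIwaniecActa1986, §3 (the dispersion method: collecting residue classes)] -/
theorem sum_boxModel_eq (box : Finset (ℕ × ℕ)) (S : Finset ℕ) (U R : ℝ) (P : ℕ) :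
    ∑ k ∈ S, U / R * (#{xy ∈ box | xy.1 ^ 3 + 2 * xy.2 ^ 3 = k ∧ Nat.Coprime k P} : ℝ) =
      U / R * #{xy ∈ box | xy.1 ^ 3 + 2 * xy.2 ^ 3 ∈ S ∧ Nat.Coprime (xy.1 ^ 3 + 2 * xy.2 ^ 3) P} := by
  rw [← mul_sum, sum_card_fiber_eq box S (fun xy => xy.1 ^ 3 + 2 * xy.2 ^ 3) (fun k => Nat.Coprime k P)]

/-- **The class sum `∑_{k ≤ N, k ≡ r (d)} ũ(k)`** when every box value lies in `[1, N]`: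
`= (U/R)·#{xy ∈ ℬ : v ≡ r (mod d), (v, P) = 1}`.
[cite: BombieriFriedlanderIwaniecActa1986, §3 (the dispersion method: collecting residue classes)] -/
theorem sum_boxModel_filter_eq (box : Finset (ℕ × ℕ)) {N : ℕ} (U R : ℝ) (P d r : ℕ)
    (hval : ∀ xy ∈ box, xy.1 ^ 3 + 2 * xy.2 ^ 3 ∈ Icc 1 N) :
    ∑ k ∈ (Icc 1 N).filter (fun k : ℕ => k ≡ r [MOD d]),
        U / R * (#{xy ∈ box | xy.1 ^ 3 + 2 * xy.2 ^ 3 = k ∧ Nat.Coprime k P} : ℝ) =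
      U / R * #{xy ∈ box | xy.1 ^ 3 + 2 * xy.2 ^ 3 ≡ r [MOD d] ∧
        Nat.Coprime (xy.1 ^ 3 + 2 * xy.2 ^ 3) P} := by
  rw [sum_boxModel_eq]
  congr 3
  refine filter_congr fun xy hxy => ?_
  rw [mem_filter]
  exact ⟨fun h => ⟨h.1.2, h.2⟩, fun h => ⟨⟨hval xy hxy, h.1⟩, h.2⟩⟩

/-- **The box model has mass `U`**: `∑_{k ≤ N} ũ(k) = U` when every box value lies in `[1, N]` and
`R ≠ 0`. [cite: Vaughan1997, §3.2 (the sieve model of the same mass)] -/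
theorem sum_boxModel_eq_mass (box : Finset (ℕ × ℕ)) {N : ℕ} (U : ℝ) (P : ℕ)
    (hval : ∀ xy ∈ box, xy.1 ^ 3 + 2 * xy.2 ^ 3 ∈ Icc 1 N)
    (hR : (#{xy ∈ box | Nat.Coprime (xy.1 ^ 3 + 2 * xy.2 ^ 3) P} : ℝ) ≠ 0) :
    ∑ k ∈ Icc 1 N, U / (#{xy ∈ box | Nat.Coprime (xy.1 ^ 3 + 2 * xy.2 ^ 3) P} : ℝ) *
        (#{xy ∈ box | xy.1 ^ 3 + 2 * xy.2 ^ 3 = k ∧ Nat.Coprime k P} : ℝ) = U := by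
  rw [sum_boxModel_eq]
  have hset : box.filter (fun xy => xy.1 ^ 3 + 2 * xy.2 ^ 3 ∈ Icc 1 N ∧
      Nat.Coprime (xy.1 ^ 3 + 2 * xy.2 ^ 3) P) =
      box.filter (fun xy => Nat.Coprime (xy.1 ^ 3 + 2 * xy.2 ^ 3) P) :=
    filter_congr fun xy hxy => ⟨fun h => h.2, fun h => ⟨hval xy hxy, h⟩⟩
  rw [hset, div_mul_cancel₀ U hR]

/-- `ũ ≥ 0` when `U ≥ 0`. [cite: Vaughan1997, §3.2 (the sieve model of the same mass)] -/
theorem boxModel_nonneg (box : Finset (ℕ × ℕ)) {U R : ℝ} (hU : 0 ≤ U) (hR : 0 ≤ R) (P k : ℕ) :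
    0 ≤ U / R * (#{xy ∈ box | xy.1 ^ 3 + 2 * xy.2 ^ 3 = k ∧ Nat.Coprime k P} : ℝ) :=
  mul_nonneg (div_nonneg hU hR) (Nat.cast_nonneg _)

/-! ### The Fundamental Lemma for a class of pairs, in ratio form -/

/-- Choice of `J` with `e^{−J}` below a prescribed positive level (private). [folklore] -/
private theorem exists_nat_exp_neg_le' {a : ℝ} (ha : 0 < a) :
    ∃ J : ℕ, 1 ≤ J ∧ Real.exp (-(J : ℝ)) ≤ a := by
  have h : Tendsto (fun J : ℕ => Real.exp (-(J : ℝ))) atTop (nhds 0) :=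
    Real.tendsto_exp_neg_atTop_nhds_zero.comp tendsto_natCast_atTop_atTop
  obtain ⟨J, hJ⟩ := ((h.eventually (eventually_le_nhds ha)).and (eventually_ge_atTop 1)).exists
  exact ⟨J, hJ.2, hJ.1⟩

/-- `V_d(z) ≥ V(z)` (the class product omits the factors at `p ∣ d`, each `≤ 1`). [cite: HeathBrownMoroz2004, Lemma 2.4] -/
theorem oneClassProduct_le_classSieveProduct (d : ℕ) (z : ℝ) :
    oneClassProduct z ≤ classSieveProduct d z := by
  rw [oneClassProduct, classSieveProduct_eq]
  refine prod_le_prod (fun p hp => ?_) fun p hp => ?_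
  · linarith [(one_sub_pairZeroCount_div_bounds (Nat.prime_of_mem_primesBelow hp)).1]
  · split_ifs
    · exact (one_sub_pairZeroCount_div_bounds (Nat.prime_of_mem_primesBelow hp)).2
    · exact le_rfl

/-- **`V_d(z) ≤ 2^{ω(d)} V(z)`** for `d ≠ 0` (each omitted factor is `≥ 1/2`). [cite: HeathBrownMoroz2004, Lemma 2.4] -/
theorem classSieveProduct_le_two_pow_mul {d : ℕ} (hd : d ≠ 0) (z : ℝ) :
    classSieveProduct d z ≤ (2 : ℝ) ^ #d.primeFactors * oneClassProduct z := by
  classical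
  rw [oneClassProduct, classSieveProduct_eq]
  set S := Nat.primesBelow ⌈z⌉₊ with hS
  -- termwise: the factor at `p ∣ d` is `1 ≤ 2 (1 − ω(p)/p²)`, else equal
  have hterm : ∀ p ∈ S, (if p ∣ d then (1 : ℝ) else 1 - (pairZeroCount p : ℝ) / (p : ℝ) ^ 2) ≤
      (if p ∣ d then (2 : ℝ) else 1) * (1 - (pairZeroCount p : ℝ) / (p : ℝ) ^ 2) := by
    intro p hp
    have hb := one_sub_pairZeroCount_div_bounds (Nat.prime_of_mem_primesBelow hp)
    split_ifs
    · linarith [hb.1]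
    · rw [one_mul]
  have h0 : ∀ p ∈ S, 0 ≤ (if p ∣ d then (1 : ℝ) else 1 - (pairZeroCount p : ℝ) / (p : ℝ) ^ 2) := by
    intro p hp
    have hb := one_sub_pairZeroCount_div_bounds (Nat.prime_of_mem_primesBelow hp)
    split_ifs
    · exact zero_le_one
    · linarith [hb.1]
  refine (prod_le_prod h0 hterm).trans ?_
  rw [prod_mul_distrib]
  refine mul_le_mul_of_nonneg_right ?_ (oneClassProduct_pos z).le
  -- `∏_{p<z} (if p ∣ d then 2 else 1) = 2^{#{p<z : p ∣ d}} ≤ 2^{ω(d)}`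
  rw [prod_ite, prod_const_one, mul_one, prod_const]
  refine pow_le_pow_right₀ (by norm_num) (card_le_card fun p hp => ?_)
  rw [mem_filter] at hp
  exact Nat.mem_primeFactors.mpr ⟨Nat.prime_of_mem_primesBelow hp.1, hp.2, hd⟩

/-- **The class sieve in RATIO FORM** (the Fundamental Lemma at `D = z^J`, `J = J(θ)`): for every `θ > 0`
there are `K ∈ ℕ` and `C > 0` such that for every modulus `d ≥ 1`, admissible class `(a, b)`, box and
`z ≥ 3` with `L/d ≥ C z^K`,
`|#{(x,y) ∈ classBoxPairs : (x³+2y³, P(z)) = 1} − (L/d)² V_d(z)| ≤ θ · (L/d)² V_d(z)`.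
[cite: HalberstamRichert1974, Thm 2.5 (Fundamental Lemma) with Thm 2.2] -/
theorem exists_classRough_ratio_le {θ : ℝ} (hθ : 0 < θ) :
    ∃ K : ℕ, ∃ C : ℝ, 0 < C ∧ ∀ (A A' L d a b : ℕ) (z : ℝ), 0 < d →
      Nat.Coprime (a ^ 3 + 2 * b ^ 3) d → 3 ≤ z → C * z ^ K ≤ (L : ℝ) / d →
      |(#{xy ∈ classBoxPairs A A' L d a b | (xy.1 ^ 3 + 2 * xy.2 ^ 3).Coprime (primesProdBelow z)} : ℝ) -
          ((L : ℝ) / d) ^ 2 * classSieveProduct d z| ≤ θ * (((L : ℝ) / d) ^ 2 * classSieveProduct d z) := by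
  obtain ⟨C₂, hC₂, hcs⟩ := abs_card_classBoxPairs_rough_sub_le
  have hK : 0 < CubicSieve.dimConst := by unfold CubicSieve.dimConst; exact Real.exp_pos _
  obtain ⟨J, hJ1, hJ⟩ := exists_nat_exp_neg_le' (a := θ / (2 * C₂)) (by positivity)
  have hJ0 : (0 : ℝ) < J := by exact_mod_cast hJ1
  have hC₂J : C₂ * Real.exp (-(J : ℝ)) ≤ θ / 2 := by
    calc C₂ * Real.exp (-(J : ℝ)) ≤ C₂ * (θ / (2 * C₂)) := mul_le_mul_of_nonneg_left hJ hC₂.le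
      _ = θ / 2 := by field_simp
  -- the growth constant: `32 C₂ K J^8 / θ` (and at least `1`)
  set CT : ℝ := 32 * C₂ * CubicSieve.dimConst * (J : ℝ) ^ 8 / θ + 1 with hCT
  have hCT1 : 1 ≤ CT := by
    have : 0 ≤ 32 * C₂ * CubicSieve.dimConst * (J : ℝ) ^ 8 / θ := by positivity
    linarith
  have hCTa : 32 * C₂ * CubicSieve.dimConst * (J : ℝ) ^ 8 / θ ≤ CT := by linarith
  refine ⟨J + 11, CT, by positivity, fun A A' L d a b z hd hab hz3 hLT => ?_⟩
  set L' : ℝ := (L : ℝ) / d with hL'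
  have hz2 : (2 : ℝ) ≤ z := by linarith
  have hz1 : (1 : ℝ) ≤ z := by linarith
  have hz0 : (0 : ℝ) < z := by linarith
  have hlogz0 : 0 < Real.log z := Real.log_pos (by linarith)
  have hlogz_le : Real.log z ≤ z := (Real.log_le_sub_one_of_pos hz0).trans (by linarith)
  set D : ℝ := z ^ J with hD
  have hzD : z ≤ D := le_self_pow₀ hz1 (by omega)
  have hD2 : 2 ≤ D := hz2.trans hzD
  have hD0 : 0 < D := by linarith
  have hD1 : 1 ≤ D := by linarith
  have hlogD : Real.log D = J * Real.log z := by rw [hD, Real.log_pow]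
  have hexp : Real.exp (-(Real.log D / Real.log z)) = Real.exp (-(J : ℝ)) := by
    rw [hlogD, mul_div_cancel_right₀ _ hlogz0.ne']
  have hlogD0 : 0 ≤ Real.log D := Real.log_nonneg hD1
  have hlogD_le : Real.log D ≤ J * z := by
    rw [hlogD]; exact mul_le_mul_of_nonneg_left hlogz_le hJ0.le
  have hlog8 : Real.log D ^ 8 ≤ ((J : ℝ) * z) ^ 8 := pow_le_pow_left₀ hlogD0 hlogD_le 8
  have hzpow1 : (1 : ℝ) ≤ z ^ (J + 11) := one_le_pow₀ hz1
  have hL'1 : (1 : ℝ) ≤ L' := (one_le_mul_of_one_le_of_one_le hCT1 hzpow1).trans hLT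
  have hL'0 : (0 : ℝ) < L' := by linarith
  have hDL : D ≤ L' := by
    calc D = z ^ J := rfl
      _ ≤ z ^ (J + 11) := pow_le_pow_right₀ hz1 (by omega)
      _ ≤ CT * z ^ (J + 11) := le_mul_of_one_le_left (by positivity) hCT1
      _ ≤ L' := hLT
  have h := hcs A A' L d a b z D hd hab hz2 hzD hD2
  rw [hexp] at h
  set V := classSieveProduct d z with hVdef
  have hV0 : 0 < V := classSieveProduct_pos d z
  have hT : 0 < L' ^ 2 * V := by positivity
  -- `V ≥ V(z) ≥ (K (log z/log 2)³)⁻¹ ≥ (8 K z³)⁻¹`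
  have hlog2 : 0 < Real.log 2 := Real.log_pos (by norm_num)
  set t : ℝ := Real.log z / Real.log 2 with ht
  have ht0 : 0 < t := div_pos hlogz0 hlog2
  have ht2z : t ≤ 2 * z := by
    have h1 : t ≤ z / Real.log 2 := div_le_div_of_nonneg_right hlogz_le hlog2.le
    have h2 : z / Real.log 2 ≤ 2 * z := by
      rw [div_le_iff₀ hlog2]
      have hl : (1 : ℝ) ≤ 2 * Real.log 2 := by
        have := Real.log_two_gt_d9; linarith
      calc z = z * 1 := (mul_one z).symm
        _ ≤ z * (2 * Real.log 2) := mul_le_mul_of_nonneg_left hl hz0.le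
        _ = 2 * z * Real.log 2 := by ring
    exact h1.trans h2
  have hKt : 0 < CubicSieve.dimConst * t ^ 3 := by positivity
  have hVlow : (CubicSieve.dimConst * t ^ 3)⁻¹ ≤ V :=
    (oneClassProduct_ge hz2).trans (oneClassProduct_le_classSieveProduct d z)
  have hV8 : 1 ≤ V * (8 * CubicSieve.dimConst * z ^ 3) := by
    have h1 : 1 ≤ V * (CubicSieve.dimConst * t ^ 3) := by
      calc (1 : ℝ) = (CubicSieve.dimConst * t ^ 3)⁻¹ * (CubicSieve.dimConst * t ^ 3) :=
            (inv_mul_cancel₀ hKt.ne').symm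
        _ ≤ V * (CubicSieve.dimConst * t ^ 3) := mul_le_mul_of_nonneg_right hVlow hKt.le
    have h2 : CubicSieve.dimConst * t ^ 3 ≤ 8 * CubicSieve.dimConst * z ^ 3 := by
      have : t ^ 3 ≤ (2 * z) ^ 3 := pow_le_pow_left₀ ht0.le ht2z 3
      calc CubicSieve.dimConst * t ^ 3 ≤ CubicSieve.dimConst * (2 * z) ^ 3 :=
            mul_le_mul_of_nonneg_left this hK.le
        _ = 8 * CubicSieve.dimConst * z ^ 3 := by ring
    exact h1.trans (mul_le_mul_of_nonneg_left h2 hV0.le)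
  have h8 : 0 < 8 * CubicSieve.dimConst * z ^ 3 := by positivity
  -- the remainder part: `C₂ (L' + D) D (log D)^8 ≤ (θ/2) L'² V`
  have hW : (L' + D) * D * Real.log D ^ 8 ≤ 2 * L' * z ^ J * ((J : ℝ) * z) ^ 8 := by
    have h1 : (L' + D) * D ≤ 2 * L' * z ^ J := by
      calc (L' + D) * D ≤ (2 * L') * D := mul_le_mul_of_nonneg_right (by linarith) hD0.le
        _ = 2 * L' * z ^ J := by rw [hD]
    exact mul_le_mul h1 hlog8 (pow_nonneg hlogD0 8) (by positivity)
  have hrem : C₂ * ((L' + D) * D * Real.log D ^ 8) ≤ θ / 2 * (L' ^ 2 * V) := by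
    have hb : 32 * C₂ * CubicSieve.dimConst * (J : ℝ) ^ 8 / θ * z ^ (J + 11) ≤ L' :=
      (mul_le_mul_of_nonneg_right hCTa (by positivity)).trans hLT
    have step2 : C₂ * (2 * L' * z ^ J * ((J : ℝ) * z) ^ 8) * (8 * CubicSieve.dimConst * z ^ 3) ≤
        θ / 2 * L' ^ 2 := by
      have e : C₂ * (2 * L' * z ^ J * ((J : ℝ) * z) ^ 8) * (8 * CubicSieve.dimConst * z ^ 3) =
          θ / 2 * L' * (32 * C₂ * CubicSieve.dimConst * (J : ℝ) ^ 8 / θ * z ^ (J + 11)) := by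
        field_simp
        ring
      rw [e]
      calc θ / 2 * L' * (32 * C₂ * CubicSieve.dimConst * (J : ℝ) ^ 8 / θ * z ^ (J + 11))
          ≤ θ / 2 * L' * L' := mul_le_mul_of_nonneg_left hb (by positivity)
        _ = θ / 2 * L' ^ 2 := by ring
    refine le_of_mul_le_mul_right ?_ h8
    calc C₂ * ((L' + D) * D * Real.log D ^ 8) * (8 * CubicSieve.dimConst * z ^ 3)
        ≤ C₂ * (2 * L' * z ^ J * ((J : ℝ) * z) ^ 8) * (8 * CubicSieve.dimConst * z ^ 3) :=
          mul_le_mul_of_nonneg_right (mul_le_mul_of_nonneg_left hW hC₂.le) h8.le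
      _ ≤ θ / 2 * L' ^ 2 := step2
      _ = θ / 2 * L' ^ 2 * 1 := (mul_one _).symm
      _ ≤ θ / 2 * L' ^ 2 * (V * (8 * CubicSieve.dimConst * z ^ 3)) :=
          mul_le_mul_of_nonneg_left hV8 (by positivity)
      _ = θ / 2 * (L' ^ 2 * V) * (8 * CubicSieve.dimConst * z ^ 3) := by ring
  -- the main-term part: `C₂ L'² V e^{−J} ≤ (θ/2) L'² V`
  have hmain : C₂ * (L' ^ 2 * V * Real.exp (-(J : ℝ))) ≤ θ / 2 * (L' ^ 2 * V) := by
    calc C₂ * (L' ^ 2 * V * Real.exp (-(J : ℝ))) = (C₂ * Real.exp (-(J : ℝ))) * (L' ^ 2 * V) := by ring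
      _ ≤ θ / 2 * (L' ^ 2 * V) := mul_le_mul_of_nonneg_right hC₂J hT.le
  calc _ ≤ C₂ * (L' ^ 2 * V * Real.exp (-(J : ℝ)) + (L' + D) * D * Real.log D ^ 8) := h
    _ = C₂ * (L' ^ 2 * V * Real.exp (-(J : ℝ))) + C₂ * ((L' + D) * D * Real.log D ^ 8) := mul_add _ _ _
    _ ≤ θ / 2 * (L' ^ 2 * V) + θ / 2 * (L' ^ 2 * V) := add_le_add hmain hrem
    _ = θ * (L' ^ 2 * V) := by ring

/-- **The one-class box count in ratio form** (the case `d = 1`): for every `θ > 0` there are `K, C`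
with `|#{(x,y) ∈ pairBox : (x³+2y³, P(z)) = 1} − L² V(z)| ≤ θ L² V(z)` whenever `z ≥ 3`, `L ≥ C z^K`.
[cite: HalberstamRichert1974, Thm 2.5 (Fundamental Lemma) with Thm 2.2] -/
theorem exists_boxRough_ratio_le {θ : ℝ} (hθ : 0 < θ) :
    ∃ K : ℕ, ∃ C : ℝ, 0 < C ∧ ∀ (A A' L : ℕ) (z : ℝ), 3 ≤ z → C * z ^ K ≤ (L : ℝ) →
      |(#{xy ∈ pairBox A A' L | (xy.1 ^ 3 + 2 * xy.2 ^ 3).Coprime (primesProdBelow z)} : ℝ) -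
          (L : ℝ) ^ 2 * oneClassProduct z| ≤ θ * ((L : ℝ) ^ 2 * oneClassProduct z) := by
  obtain ⟨K, C, hC, h⟩ := exists_classRough_ratio_le hθ
  refine ⟨K, C, hC, fun A A' L z hz hL => ?_⟩
  have hab : Nat.Coprime (0 ^ 3 + 2 * 0 ^ 3) 1 := Nat.coprime_one_right _
  have h1 := h A A' L 1 0 0 z one_pos hab hz (by simpa using hL)
  have hV : classSieveProduct 1 z = oneClassProduct z := by
    rw [← densityProduct_seqPairBox_eq A A' L 1 0 0 z, densityProduct_seqPairBox_one_eq]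
  simpa [classBoxPairs_one, hV] using h1

/-! ### The box model has the local densities of `x³ + 2y³` -/

/-- Elementary: if `n ∈ [νT(1−θ), νT(1+θ)]`, `R ∈ [ν⋆T(1−θ), ν⋆T(1+θ)]`, `0 ≤ ν ≤ ν⋆`, `1 ≤ ν⋆`,
`T > 0`, `0 < θ ≤ 1/4`, then `|n/R − ν/ν⋆| ≤ 3θ` (private). [folklore] -/
private theorem abs_div_sub_div_le_of_bounds {n R ν νs T θ : ℝ} (hT : 0 < T) (hθ : 0 < θ)
    (hθ4 : θ ≤ 1 / 4) (hν0 : 0 ≤ ν) (hνs : ν ≤ νs) (hνs1 : 1 ≤ νs)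
    (hn1 : ν * T * (1 - θ) ≤ n) (hn2 : n ≤ ν * T * (1 + θ))
    (hR1 : νs * T * (1 - θ) ≤ R) (hR2 : R ≤ νs * T * (1 + θ)) : |n / R - ν / νs| ≤ 3 * θ := by
  have hνs0 : 0 < νs := by linarith
  have hR0 : 0 < R := by
    have : 0 < νs * T * (1 - θ) := by
      have : 0 < 1 - θ := by linarith
      positivity
    linarith
  rw [div_sub_div _ _ hR0.ne' hνs0.ne', abs_div, abs_of_pos (mul_pos hR0 hνs0),
    div_le_iff₀ (mul_pos hR0 hνs0), abs_le]
  -- linear consequences, with the products spelled out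
  set P := ν * νs * T with hP
  have hP0 : 0 ≤ P := by rw [hP]; exact mul_nonneg (mul_nonneg hν0 hνs0.le) hT.le
  have h1 : n * νs ≤ P + θ * P := by
    have := mul_le_mul_of_nonneg_right hn2 hνs0.le
    have e : ν * T * (1 + θ) * νs = P + θ * P := by rw [hP]; ring
    linarith [e]
  have h2 : P - θ * P ≤ R * ν := by
    have := mul_le_mul_of_nonneg_left hR1 hν0
    have e : ν * (νs * T * (1 - θ)) = P - θ * P := by rw [hP]; ring
    have e2 : ν * R = R * ν := mul_comm _ _
    linarith [e, e2]
  have h3 : P - θ * P ≤ n * νs := by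
    have := mul_le_mul_of_nonneg_right hn1 hνs0.le
    have e : ν * T * (1 - θ) * νs = P - θ * P := by rw [hP]; ring
    linarith [e]
  have h4 : R * ν ≤ P + θ * P := by
    have := mul_le_mul_of_nonneg_left hR2 hν0
    have e : ν * (νs * T * (1 + θ)) = P + θ * P := by rw [hP]; ring
    have e2 : ν * R = R * ν := mul_comm _ _
    linarith [e, e2]
  -- `2 θ P ≤ 3 θ R νs` (from `R ≥ νs T (1 − θ) ≥ (3/4) νs T ≥ (3/4) ν T`)
  have h5 : 2 * (θ * P) ≤ 3 * θ * (R * νs) := by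
    have hR34 : νs * T * (3 / 4) ≤ R := by
      have : νs * T * (3 / 4) ≤ νs * T * (1 - θ) :=
        mul_le_mul_of_nonneg_left (by linarith) (mul_nonneg hνs0.le hT.le)
      exact this.trans hR1
    have hνT : ν * T ≤ νs * T := mul_le_mul_of_nonneg_right hνs hT.le
    -- `2 P = 2 ν νs T ≤ 2 νs · νs T ≤ ...`: compare `2 ν T` with `3 R`
    have h6 : 2 * (ν * T) ≤ 3 * R := by nlinarith [mul_nonneg hν0 hT.le]
    have e : θ * P = (θ * νs) * (ν * T) := by rw [hP]; ring
    rw [e]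
    have hθνs : 0 ≤ θ * νs := mul_nonneg hθ.le hνs0.le
    calc 2 * (θ * νs * (ν * T)) = (θ * νs) * (2 * (ν * T)) := by ring
      _ ≤ (θ * νs) * (3 * R) := mul_le_mul_of_nonneg_left h6 hθνs
      _ = 3 * θ * (R * νs) := by ring
  constructor <;> linarith

/-- **The box model has the local densities of `x³ + 2y³`** (up to the sieve ratio error): let
`d ≥ 1` have all its prime factors below `z`, let `0 < θ ≤ 1/4`, `L ≥ 1`, and suppose every
ADMISSIBLE class count `#{(x,y) ∈ classBoxPairs(d;a,b) : (x³+2y³, P(z)) = 1}` lies within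
`θ (L/d)² V_d(z)` of `(L/d)² V_d(z)`. Then for every `r`,
`|#{ℬ : v ≡ r (d), (v,P(z)) = 1} / #{ℬ : (v,P(z)) = 1} − #{(a,b) mod d : a³+2b³ ≡ r, (a³+2b³,d)=1}/#{(a,b) mod d : (a³+2b³,d)=1}| ≤ 3θ`.
[cite: HeathBrownMoroz2004, §2 (2.3)–(2.4) (local densities of the sifted sequence in residue classes)] -/
theorem abs_classCount_div_sub_density_le {A A' L d : ℕ} {z θ : ℝ} (hd : 0 < d) (hL : 0 < L)
    (hdz : ∀ p : ℕ, p.Prime → p ∣ d → (p : ℝ) < z) (hθ : 0 < θ) (hθ4 : θ ≤ 1 / 4)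
    (hclass : ∀ a b : ℕ, Nat.Coprime (a ^ 3 + 2 * b ^ 3) d →
      |(#{xy ∈ classBoxPairs A A' L d a b | (xy.1 ^ 3 + 2 * xy.2 ^ 3).Coprime (primesProdBelow z)} : ℝ) -
          ((L : ℝ) / d) ^ 2 * classSieveProduct d z| ≤ θ * (((L : ℝ) / d) ^ 2 * classSieveProduct d z))
    (r : ℕ) :
    |(#{xy ∈ Ioc A (A + L) ×ˢ Ioc A' (A' + L) | xy.1 ^ 3 + 2 * xy.2 ^ 3 ≡ r [MOD d] ∧
          (xy.1 ^ 3 + 2 * xy.2 ^ 3).Coprime (primesProdBelow z)} : ℝ) /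
        (#{xy ∈ Ioc A (A + L) ×ˢ Ioc A' (A' + L) | (xy.1 ^ 3 + 2 * xy.2 ^ 3).Coprime (primesProdBelow z)} : ℝ) -
      (#{ab ∈ range d ×ˢ range d | ab.1 ^ 3 + 2 * ab.2 ^ 3 ≡ r [MOD d] ∧
          Nat.Coprime (ab.1 ^ 3 + 2 * ab.2 ^ 3) d} : ℝ) /
        (#{ab ∈ range d ×ˢ range d | Nat.Coprime (ab.1 ^ 3 + 2 * ab.2 ^ 3) d} : ℝ)| ≤ 3 * θ := by
  classical
  set T : ℝ := ((L : ℝ) / d) ^ 2 * classSieveProduct d z with hTdef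
  have hT : 0 < T := by
    have : (0 : ℝ) < (L : ℝ) / d := div_pos (by exact_mod_cast hL) (by exact_mod_cast hd)
    rw [hTdef]; exact mul_pos (pow_pos this 2) (classSieveProduct_pos d z)
  -- abbreviations for the class counts
  set nab : ℕ × ℕ → ℝ := fun ab =>
    (#{xy ∈ classBoxPairs A A' L d ab.1 ab.2 | (xy.1 ^ 3 + 2 * xy.2 ^ 3).Coprime (primesProdBelow z)} : ℝ)
    with hnab
  have hadm : ∀ ab : ℕ × ℕ, Nat.Coprime (ab.1 ^ 3 + 2 * ab.2 ^ 3) d →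
      T * (1 - θ) ≤ nab ab ∧ nab ab ≤ T * (1 + θ) := by
    intro ab hab
    have h := abs_le.mp (hclass ab.1 ab.2 hab)
    constructor <;> [skip; skip] <;> simp only [hnab] <;> nlinarith [h.1, h.2]
  have hinadm : ∀ ab : ℕ × ℕ, ¬ Nat.Coprime (ab.1 ^ 3 + 2 * ab.2 ^ 3) d → nab ab = 0 := by
    intro ab hab
    simp only [hnab]
    rw [card_classBoxPairs_rough_eq_zero hab hdz, Nat.cast_zero]
  -- the class-r count and the total count as sums over classes of pairs
  have hnr : (#{xy ∈ Ioc A (A + L) ×ˢ Ioc A' (A' + L) | xy.1 ^ 3 + 2 * xy.2 ^ 3 ≡ r [MOD d] ∧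
      (xy.1 ^ 3 + 2 * xy.2 ^ 3).Coprime (primesProdBelow z)} : ℝ) =
      ∑ ab ∈ (range d ×ˢ range d).filter (fun ab : ℕ × ℕ => ab.1 ^ 3 + 2 * ab.2 ^ 3 ≡ r [MOD d]),
        nab ab := by
    rw [card_box_modEq_rough_eq_sum hd, Nat.cast_sum]
  have hR : (#{xy ∈ Ioc A (A + L) ×ˢ Ioc A' (A' + L) |
      (xy.1 ^ 3 + 2 * xy.2 ^ 3).Coprime (primesProdBelow z)} : ℝ) = ∑ ab ∈ range d ×ˢ range d, nab ab := by
    rw [card_box_rough_eq_sum hd, Nat.cast_sum]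
  -- the admissible classes
  set Adm := (range d ×ˢ range d).filter (fun ab : ℕ × ℕ => Nat.Coprime (ab.1 ^ 3 + 2 * ab.2 ^ 3) d)
    with hAdm
  set νs : ℝ := (#Adm : ℝ) with hνs
  have hνs1 : 1 ≤ νs := by
    have h10 : ((1 : ℕ) % d, 0) ∈ Adm := by
      rw [hAdm, mem_filter, mem_product, mem_range, mem_range]
      refine ⟨⟨Nat.mod_lt _ hd, hd⟩, ?_⟩
      simp only [ne_eq, OfNat.ofNat_ne_zero, not_false_eq_true, zero_pow, mul_zero, add_zero]
      have h1 : (1 % d) ^ 3 ≡ 1 [MOD d] := by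
        have := (Nat.mod_modEq 1 d).pow 3
        simpa using this
      rw [Nat.Coprime, h1.gcd_eq]
      exact Nat.gcd_one_left d
    have : 1 ≤ #Adm := card_pos.mpr ⟨_, h10⟩
    rw [hνs]; exact_mod_cast this
  -- total: `R = ∑_{Adm} nab`
  have hRsum : ∑ ab ∈ range d ×ˢ range d, nab ab = ∑ ab ∈ Adm, nab ab := by
    rw [hAdm, sum_filter]
    refine sum_congr rfl fun ab _ => ?_
    split_ifs with h
    · rfl
    · exact hinadm ab h
  have hR1 : νs * T * (1 - θ) ≤ ∑ ab ∈ range d ×ˢ range d, nab ab := by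
    rw [hRsum]
    calc νs * T * (1 - θ) = ∑ _ab ∈ Adm, T * (1 - θ) := by rw [sum_const, nsmul_eq_mul, hνs]; ring
      _ ≤ ∑ ab ∈ Adm, nab ab := sum_le_sum fun ab hab => (hadm ab (mem_filter.mp hab).2).1
  have hR2 : ∑ ab ∈ range d ×ˢ range d, nab ab ≤ νs * T * (1 + θ) := by
    rw [hRsum]
    calc ∑ ab ∈ Adm, nab ab ≤ ∑ _ab ∈ Adm, T * (1 + θ) :=
          sum_le_sum fun ab hab => (hadm ab (mem_filter.mp hab).2).2
      _ = νs * T * (1 + θ) := by rw [sum_const, nsmul_eq_mul, hνs]; ring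
  rw [hnr, hR]
  by_cases hr : Nat.Coprime r d
  · -- all classes with `a³ + 2b³ ≡ r` are admissible
    set Cr := (range d ×ˢ range d).filter (fun ab : ℕ × ℕ => ab.1 ^ 3 + 2 * ab.2 ^ 3 ≡ r [MOD d]) with hCr
    have hCr_adm : ∀ ab ∈ Cr, Nat.Coprime (ab.1 ^ 3 + 2 * ab.2 ^ 3) d := by
      intro ab hab
      rw [hCr, mem_filter] at hab
      rw [Nat.Coprime, hab.2.gcd_eq]; exact hr
    have hnum : (#{ab ∈ range d ×ˢ range d | ab.1 ^ 3 + 2 * ab.2 ^ 3 ≡ r [MOD d] ∧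
        Nat.Coprime (ab.1 ^ 3 + 2 * ab.2 ^ 3) d} : ℝ) = #Cr := by
      congr 2
      exact filter_congr fun ab hab => ⟨fun h => h.1, fun h => ⟨h, by rw [Nat.Coprime, h.gcd_eq]; exact hr⟩⟩
    rw [hnum]
    set ν : ℝ := (#Cr : ℝ) with hν
    have hν0 : 0 ≤ ν := Nat.cast_nonneg _
    have hνle : ν ≤ νs := by
      rw [hν, hνs]
      exact_mod_cast card_le_card fun ab hab => by
        rw [hAdm, mem_filter]
        exact ⟨(mem_filter.mp hab).1, hCr_adm ab hab⟩
    have hn1 : ν * T * (1 - θ) ≤ ∑ ab ∈ Cr, nab ab := by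
      calc ν * T * (1 - θ) = ∑ _ab ∈ Cr, T * (1 - θ) := by rw [sum_const, nsmul_eq_mul, hν]; ring
        _ ≤ ∑ ab ∈ Cr, nab ab := sum_le_sum fun ab hab => (hadm ab (hCr_adm ab hab)).1
    have hn2 : ∑ ab ∈ Cr, nab ab ≤ ν * T * (1 + θ) := by
      calc ∑ ab ∈ Cr, nab ab ≤ ∑ _ab ∈ Cr, T * (1 + θ) :=
            sum_le_sum fun ab hab => (hadm ab (hCr_adm ab hab)).2
        _ = ν * T * (1 + θ) := by rw [sum_const, nsmul_eq_mul, hν]; ring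
    exact abs_div_sub_div_le_of_bounds hT hθ hθ4 hν0 hνle hνs1 hn1 hn2 hR1 hR2
  · -- no class with `a³ + 2b³ ≡ r` is admissible: both ratios vanish
    have hnum : (#{ab ∈ range d ×ˢ range d | ab.1 ^ 3 + 2 * ab.2 ^ 3 ≡ r [MOD d] ∧
        Nat.Coprime (ab.1 ^ 3 + 2 * ab.2 ^ 3) d} : ℝ) = 0 := by
      rw [Nat.cast_eq_zero, card_eq_zero, filter_eq_empty_iff]
      intro ab _ h
      apply hr
      rw [Nat.Coprime, ← h.1.gcd_eq]; exact h.2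
    have hsum0 : ∑ ab ∈ (range d ×ˢ range d).filter (fun ab : ℕ × ℕ => ab.1 ^ 3 + 2 * ab.2 ^ 3 ≡ r [MOD d]),
        nab ab = 0 := by
      refine sum_eq_zero fun ab hab => hinadm ab fun hcop => hr ?_
      rw [mem_filter] at hab
      rw [Nat.Coprime, ← hab.2.gcd_eq]; exact hcop
    rw [hnum, hsum0, zero_div, zero_div, sub_zero, abs_zero]
    positivity

/-- **Class sums of the box model against the local density** (the form the dispersion consumes):
under the hypotheses of `abs_classCount_div_sub_density_le`, with `U ≥ 0` and all box values in `[1, N]`,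
`|∑_{k ≤ N, k ≡ r (d)} ũ(k) − ρ(d, r)·U| ≤ 3θ·U`, `ρ(d,r) = #{(a,b): a³+2b³ ≡ r, coprime}/#{(a,b): coprime}`.
[cite: HeathBrownMoroz2004, §2 (2.3)–(2.4) (local densities of the sifted sequence in residue classes)] -/
theorem abs_sum_boxModel_filter_sub_le {A A' L d N : ℕ} {z θ U : ℝ} (hd : 0 < d) (hL : 0 < L)
    (hdz : ∀ p : ℕ, p.Prime → p ∣ d → (p : ℝ) < z) (hθ : 0 < θ) (hθ4 : θ ≤ 1 / 4) (hU : 0 ≤ U)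
    (hval : ∀ xy ∈ Ioc A (A + L) ×ˢ Ioc A' (A' + L), xy.1 ^ 3 + 2 * xy.2 ^ 3 ∈ Icc 1 N)
    (hclass : ∀ a b : ℕ, Nat.Coprime (a ^ 3 + 2 * b ^ 3) d →
      |(#{xy ∈ classBoxPairs A A' L d a b | (xy.1 ^ 3 + 2 * xy.2 ^ 3).Coprime (primesProdBelow z)} : ℝ) -
          ((L : ℝ) / d) ^ 2 * classSieveProduct d z| ≤ θ * (((L : ℝ) / d) ^ 2 * classSieveProduct d z))
    (r : ℕ) :
    |∑ k ∈ (Icc 1 N).filter (fun k : ℕ => k ≡ r [MOD d]),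
        U / (#{xy ∈ Ioc A (A + L) ×ˢ Ioc A' (A' + L) |
            (xy.1 ^ 3 + 2 * xy.2 ^ 3).Coprime (primesProdBelow z)} : ℝ) *
          (#{xy ∈ Ioc A (A + L) ×ˢ Ioc A' (A' + L) |
            xy.1 ^ 3 + 2 * xy.2 ^ 3 = k ∧ Nat.Coprime k (primesProdBelow z)} : ℝ) -
      (#{ab ∈ range d ×ˢ range d | ab.1 ^ 3 + 2 * ab.2 ^ 3 ≡ r [MOD d] ∧
          Nat.Coprime (ab.1 ^ 3 + 2 * ab.2 ^ 3) d} : ℝ) /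
        (#{ab ∈ range d ×ˢ range d | Nat.Coprime (ab.1 ^ 3 + 2 * ab.2 ^ 3) d} : ℝ) * U| ≤ 3 * θ * U := by
  have h := abs_classCount_div_sub_density_le (A := A) (A' := A') hd hL hdz hθ hθ4 hclass r
  rw [sum_boxModel_filter_eq _ U _ (primesProdBelow z) d r hval]
  set R : ℝ := (#{xy ∈ Ioc A (A + L) ×ˢ Ioc A' (A' + L) |
    (xy.1 ^ 3 + 2 * xy.2 ^ 3).Coprime (primesProdBelow z)} : ℝ) with hR
  set n : ℝ := (#{xy ∈ Ioc A (A + L) ×ˢ Ioc A' (A' + L) | xy.1 ^ 3 + 2 * xy.2 ^ 3 ≡ r [MOD d] ∧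
    (xy.1 ^ 3 + 2 * xy.2 ^ 3).Coprime (primesProdBelow z)} : ℝ) with hn
  set ρ : ℝ := (#{ab ∈ range d ×ˢ range d | ab.1 ^ 3 + 2 * ab.2 ^ 3 ≡ r [MOD d] ∧
      Nat.Coprime (ab.1 ^ 3 + 2 * ab.2 ^ 3) d} : ℝ) /
    (#{ab ∈ range d ×ˢ range d | Nat.Coprime (ab.1 ^ 3 + 2 * ab.2 ^ 3) d} : ℝ) with hρ
  rw [show U / R * n - ρ * U = U * (n / R - ρ) by ring, abs_mul, abs_of_nonneg hU]
  calc U * |n / R - ρ| ≤ U * (3 * θ) := mul_le_mul_of_nonneg_left h hU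
    _ = 3 * θ * U := by ring

end Literature.NumberTheory.Sieve.CubicMinorant

end
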